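import Summits.KontsevichZagierPeriods.KontsevichZagierPeriods.Theorems.LiftingCriteriaDilationTransferOfTameStokes
import Summits.KontsevichZagierPeriods.KontsevichZagierPeriods.Theorems.LiftingCriteriaDilationTransferSquarePyramid
import Literature.NumberTheory.Transcendental.KZDilationLogSector
import Summits.KontsevichZagierPeriods.KontsevichZagierPeriods.Theorems.PlanarAreas.Negative.GreenBandsSubbandStrip

/-!
# Homogeneous dilation relations on the square, I: the moves at a rational scale (crux `DilationTransfer`, stmt-KontsevichZagierPeriods-3572)

Support file for crux `DilationTransfer` (route `LiftingCriteria`, line `birth`, reshape 4), first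
unconditional rung above pencil dimension one. Data: cube-Nash `gᵢ` of dimensions `nᵢ ≤ 2`,
integers `mᵢ, m₀`, read on the square as `F(y) = m₀ + Σ mᵢ gᵢ(πᵢ y)`; a Nash `R` near the lower
triangle `P = {y ∈ [0,1]² | y₁ ≤ y₀}` with a fibre derivative `Rt = ∂R/∂y₁` on `P`. For every
rational scale `σ ∈ (0,1]`, `homog_scale_moves_rem` runs the moves
`[[0,1]², F(σ·)] ≡ [P, F(σ·) + F(σ·)∘σ]` (pyramid, `square_pyramid`)
`≡ [P, Rt(σ·)] + [P, remainder]` (integrand additivity; the remainder is ASSUMED to be a relation)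
`≡ [[0,1], s ↦ (R(σs,σs) − R(σs,0))/σ]` (Newton–Leibniz on the triangle, rescaled primitive
`R(σ·)/σ`), and computes both values (`∫_{[0,1]²} F(σy)dy = m₀ + Σ mᵢ ∫ gᵢ(σz)dz`: padding is a
relation and relations preserve values). `homog_scale_moves` is the EXACT case `Rt = F + F∘σ`
(remainder `0`). The companion file `…HomogDimTwoExactSym.lean` feeds in the homogeneous relation.

## References
* M. Kontsevich, D. Zagier, *Periods* (2001), §1.2 (rules (1)–(3)).
-/

noncomputable section

open scoped BigOperators
open MeasureTheory Set Filter
open Literature.NumberTheory.Transcendental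
open Literature.ModelTheory.ExponentialFields (IsSemialgebraic)
open Summit.KontsevichZagierPeriods.PlanarAreas.Negative.GreenBands (snoc_fin_one)

namespace Summit.KontsevichZagierPeriods.LiftingCriteria.DilationTransfer

/-! ### Small toolkit on `ℝ¹` and `ℝ²` -/

/-- Scaling a vector of `ℝ²`. [folklore] -/
theorem smul_vec_two (c a b : ℝ) : c • (![a, b] : Fin 2 → ℝ) = ![c * a, c * b] := by
  ext i
  fin_cases i <;> simp

/-- Scaling by `c ∈ [0,1]` maps the lower triangle into itself. [folklore] -/
theorem smul_mem_lowerTriangle {c : ℝ} (hc0 : 0 ≤ c) (hc1 : c ≤ 1) {y : Fin 2 → ℝ}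
    (hy : y ∈ {y : Fin 2 → ℝ | y ∈ KZ.cube 2 ∧ y 1 ≤ y 0}) :
    c • y ∈ {y : Fin 2 → ℝ | y ∈ KZ.cube 2 ∧ y 1 ≤ y 0} :=
  ⟨smul_mem_cube_of_le hc0 hc1 hy.1, by
    simp only [Pi.smul_apply, smul_eq_mul]
    exact mul_le_mul_of_nonneg_left hy.2 hc0⟩

/-- The fibre point `(x₀, t)` of the triangle for `0 ≤ t ≤ x₀ ≤ 1`. [folklore] -/
theorem snoc_mem_lowerTriangle {x : Fin 1 → ℝ} (hx : x ∈ KZ.cube 1) {t : ℝ} (ht0 : 0 ≤ t)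
    (ht : t ≤ x 0) : (Fin.snoc x t : Fin 2 → ℝ) ∈ {y : Fin 2 → ℝ | y ∈ KZ.cube 2 ∧ y 1 ≤ y 0} := by
  have h0 := KZ.mem_cube.1 hx 0
  rw [snoc_fin_one]
  refine ⟨fun i => ?_, by simpa using ht⟩
  fin_cases i
  · simpa using h0
  · simpa using ⟨ht0, ht.trans h0.2⟩

/-- Scaling by a rational is a `ℚ`-semialgebraic self-map of every `ℚ`-semialgebraic set.
[cite: BochnakCosteRoy1998, §2.2] -/
theorem isSemialgebraicMapOn_smul {k : ℕ} {s : Set (Fin k → ℝ)} (hs : IsSemialgebraic ℚ s) (c : ℚ) :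
    IsSemialgebraicMapOn ℚ s (fun y : Fin k → ℝ => (c : ℝ) • y) :=
  IsSemialgebraicMapOn.of_forall hs fun j =>
    ((isSemialgebraicFunOn_const_ratCast hs c).fun_mul (isSemialgebraicFunOn_apply hs j)).congr
      fun y _ => by simp [Pi.smul_apply, smul_eq_mul]

/-! ### The moves at a rational scale -/

/-- **Homogeneous data on the square at a rational scale `σ ∈ (0,1]`: the moves and the values.**
For cube-Nash `gᵢ` (`nᵢ ≤ 2`), integers `mᵢ, m₀`, and a Nash `R` near the lower triangle `P` with
`∂R/∂y₁ = F + F∘σ` on `P` (`F(y) = m₀ + Σ mᵢ gᵢ(πᵢ y)`), there are representations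
`A = [[0,1]², F(σ·)]` and `Z = [[0,1], s ↦ (R(σs,σs) − R(σs,0))/σ]` with `[A] − [Z] ∈ KZ.relations`
(pyramid `square_pyramid`, then `triangle_newtonLeibniz` with the rescaled primitive `R(σ·)/σ`),
`value A = m₀ + Σ mᵢ ∫_{[0,1]^{nᵢ}} gᵢ(σz)dz` (padding `tame_liftLE` preserves values) and
`value Z = ∫_{[0,1]} (R(σs,σs) − R(σs,0))/σ ds`. GENERAL FORM: `R` comes with a fibre
derivative `Rt` (`∂R/∂y₁ = Rt` on `P`, semialgebraic and continuous there) and the REMAINDER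
`(F(σ·) + F(σ·)∘σ) − Rt(σ·)` on `P` is only assumed to carry a relation (`hRem`); the exact case
`Rt = F + F∘σ` is `homog_scale_moves`. [cite: KontsevichZagier2001, §1.2] -/
theorem homog_scale_moves_rem {S : ℕ} {n : Fin S → ℕ} {g : (i : Fin S) → (Fin (n i) → ℝ) → ℝ}
    {U : (i : Fin S) → Set (Fin (n i) → ℝ)}
    (hg : ∀ i, IsOpen (U i) ∧ Set.pi Set.univ (fun _ : Fin (n i) => Set.Icc (0:ℝ) 1) ⊆ (U i) ∧
      IsSemialgebraicFunOn ℚ (U i) (g i) ∧ AnalyticOnNhd ℝ (g i) (U i))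
    (hn2 : ∀ i, n i ≤ 2) (m : Fin S → ℤ) (m₀ : ℤ)
    {W : Set (Fin 2 → ℝ)} {R : (Fin 2 → ℝ) → ℝ}
    (hPW : {y : Fin 2 → ℝ | y ∈ KZ.cube 2 ∧ y 1 ≤ y 0} ⊆ W)
    (hRs : IsSemialgebraicFunOn ℚ W R) (hRa : AnalyticOnNhd ℝ R W)
    {Rt : (Fin 2 → ℝ) → ℝ} (hRts : IsSemialgebraicFunOn ℚ {y : Fin 2 → ℝ | y ∈ KZ.cube 2 ∧ y 1 ≤ y 0} Rt)
    (hRtc : ContinuousOn Rt {y : Fin 2 → ℝ | y ∈ KZ.cube 2 ∧ y 1 ≤ y 0})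
    (hRtd : ∀ a t : ℝ, (![a, t] : Fin 2 → ℝ) ∈ {y : Fin 2 → ℝ | y ∈ KZ.cube 2 ∧ y 1 ≤ y 0} →
      HasDerivAt (fun t : ℝ => R ![a, t]) (Rt ![a, t]) t)
    (σ : ℚ) (hσ0 : 0 < σ) (hσ1 : σ ≤ 1)
    (hRem : ∀ N : KZ.IntegralRep 2, N.domain = {y : Fin 2 → ℝ | y ∈ KZ.cube 2 ∧ y 1 ≤ y 0} →
      (∀ y ∈ {y : Fin 2 → ℝ | y ∈ KZ.cube 2 ∧ y 1 ≤ y 0}, N.integrand y =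
        (((m₀ : ℝ) + ∑ i, (m i : ℝ) * g i ((σ : ℝ) • (fun l : Fin (n i) => y (Fin.castLE (hn2 i) l)))) +
         ((m₀ : ℝ) + ∑ i, (m i : ℝ) * g i ((σ : ℝ) • (fun l : Fin (n i) => y (Equiv.swap (0 : Fin 2) 1 (Fin.castLE (hn2 i) l)))))) -
        Rt ((σ : ℝ) • y)) → KZ.of N ∈ KZ.relations) :
    ∃ (A : KZ.IntegralRep 2) (Z : KZ.IntegralRep 1),
      A.domain = KZ.cube 2 ∧
      (∀ v, A.integrand v = (m₀ : ℝ) + ∑ i, (m i : ℝ) * g i ((σ : ℝ) • (fun l : Fin (n i) => v (Fin.castLE (hn2 i) l)))) ∧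
      Z.domain = KZ.cube 1 ∧
      (∀ x, Z.integrand x = (R ((σ : ℝ) • (![x 0, x 0] : Fin 2 → ℝ)) - R ((σ : ℝ) • (![x 0, 0] : Fin 2 → ℝ))) / σ) ∧
      KZ.of A - KZ.of Z ∈ KZ.relations ∧
      A.value = (m₀ : ℝ) + ∑ i, (m i : ℝ) * (∫ z in Set.pi Set.univ (fun _ : Fin (n i) => Set.Icc (0:ℝ) 1), g i ((σ : ℝ) • z)) ∧
      Z.value = ∫ s in Set.Icc (0:ℝ) 1, (R ((σ : ℝ) • (![s, s] : Fin 2 → ℝ)) - R ((σ : ℝ) • (![s, 0] : Fin 2 → ℝ))) / σ := by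
  set P : Set (Fin 2 → ℝ) := {y : Fin 2 → ℝ | y ∈ KZ.cube 2 ∧ y 1 ≤ y 0} with hP
  have hσ0' : (0 : ℝ) < (σ : ℝ) := by exact_mod_cast hσ0
  have hσ0le : (0 : ℝ) ≤ (σ : ℝ) := hσ0'.le
  have hσ1' : (σ : ℝ) ≤ 1 := by exact_mod_cast hσ1
  have hσne : (σ : ℝ) ≠ 0 := hσ0'.ne'
  have hcubeU : ∀ i, KZ.cube (n i) ⊆ U i := fun i => by rw [KZ.cube_eq_pi]; exact (hg i).2.1
  have ha : ∀ i, AnalyticOnNhd ℝ (fun z : Fin (n i) → ℝ => g i ((σ : ℝ) • z)) (KZ.cube (n i)) := by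
    intro i z hz
    have hgz : AnalyticAt ℝ (g i) ((σ : ℝ) • z) :=
      (hg i).2.2.2 _ (hcubeU i (smul_mem_cube_of_le hσ0le hσ1' hz))
    exact hgz.comp (((σ : ℝ) • ContinuousLinearMap.id ℝ (Fin (n i) → ℝ)).analyticAt z)
  have hs : ∀ i, IsSemialgebraicFunOn ℚ (KZ.cube (n i)) (fun z : Fin (n i) → ℝ => g i ((σ : ℝ) • z)) :=
    fun i => IsSemialgebraicFunOn.comp_isSemialgebraicMapOn_holds (hg i).2.2.1
      (isSemialgebraicMapOn_smul KZ.isSemialgebraic_cube σ)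
      fun z hz => hcubeU i (smul_mem_cube_of_le hσ0le hσ1' hz)
  have hFs : IsSemialgebraicFunOn ℚ (KZ.cube 2) (fun v : Fin 2 → ℝ =>
      (m₀ : ℝ) + ∑ i, (m i : ℝ) * g i ((σ : ℝ) • (fun l : Fin (n i) => v (Fin.castLE (hn2 i) l)))) :=
    (isSemialgebraicFunOn_const_intCast KZ.isSemialgebraic_cube m₀).fun_add
      (IsSemialgebraicFunOn.fun_finsetSum Finset.univ KZ.isSemialgebraic_cube fun i _ =>
        (isSemialgebraicFunOn_const_intCast KZ.isSemialgebraic_cube (m i)).fun_mul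
          (isSemialgebraicFunOn_cube_comp_castLE (hn2 i) (hs i)))
  have hFa : AnalyticOnNhd ℝ (fun v : Fin 2 → ℝ =>
      (m₀ : ℝ) + ∑ i, (m i : ℝ) * g i ((σ : ℝ) • (fun l : Fin (n i) => v (Fin.castLE (hn2 i) l)))) (KZ.cube 2) := by
    intro v hv
    exact analyticAt_const.fun_add (Finset.analyticAt_fun_sum (f := fun i (v : Fin 2 → ℝ) =>
      (m i : ℝ) * g i ((σ : ℝ) • (fun l : Fin (n i) => v (Fin.castLE (hn2 i) l)))) Finset.univ
      fun i _ => analyticAt_const.fun_mul (analyticOnNhd_comp_castLE (hn2 i) (ha i) v hv))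
  set A : KZ.IntegralRep 2 := KZ.IntegralRep.tameCube _ hFa hFs with hA
  obtain ⟨T, hTd, hTi, hAT⟩ := square_pyramid A rfl
  -- (3) the exact part `X = [P, Rt(σ·)]` and the remainder `N = [P, T − Rt(σ·)]`
  have hPs : IsSemialgebraic ℚ P := isSemialgebraic_lowerTriangle
  have hPσP : ∀ {y}, y ∈ P → (σ : ℝ) • y ∈ P := fun hy => smul_mem_lowerTriangle hσ0le hσ1' hy
  have hσP : ∀ {y}, y ∈ P → (σ : ℝ) • y ∈ W := fun hy => hPW (hPσP hy)
  have hPcpt : IsCompact P :=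
    KZ.isCompact_cube.of_isClosed_subset
      (KZ.isClosed_cube.inter (isClosed_le (continuous_apply 1) (continuous_apply 0))) fun y hy => hy.1
  have hXs : IsSemialgebraicFunOn ℚ P (fun y : Fin 2 → ℝ => Rt ((σ : ℝ) • y)) :=
    IsSemialgebraicFunOn.comp_isSemialgebraicMapOn_holds hRts (isSemialgebraicMapOn_smul hPs σ)
      fun y hy => hPσP hy
  have hXc : ContinuousOn (fun y : Fin 2 → ℝ => Rt ((σ : ℝ) • y)) P :=
    hRtc.comp (continuous_const_smul (σ : ℝ)).continuousOn fun y hy => hPσP hy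
  let X : KZ.IntegralRep 2 :=
    { domain := P
      integrand := fun y => Rt ((σ : ℝ) • y)
      isSemialgebraic_domain := hPs
      isSemialgebraicFunOn_integrand := hXs
      integrableOn := hXc.integrableOn_compact hPcpt }
  have hTs : IsSemialgebraicFunOn ℚ P T.integrand := by
    have h := T.isSemialgebraicFunOn_integrand; rwa [hTd] at h
  have hTint : IntegrableOn T.integrand P := by
    have h := T.integrableOn; rwa [hTd] at h
  let N : KZ.IntegralRep 2 :=
    { domain := P
      integrand := fun y => T.integrand y - Rt ((σ : ℝ) • y)
      isSemialgebraic_domain := hPs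
      isSemialgebraicFunOn_integrand := hTs.fun_sub hXs
      integrableOn := hTint.sub (hXc.integrableOn_compact hPcpt) }
  have hTXN : KZ.of T - KZ.of X - KZ.of N ∈ KZ.integrandAddRel :=
    ⟨2, T, X, N, hTd.symm, hTd.symm, fun y _ => by simp [X, N], rfl⟩
  have hN : KZ.of N ∈ KZ.relations := by
    refine hRem N rfl fun y hy => ?_
    simp only [N, hTi, hA, KZ.IntegralRep.tameCube_integrand]
  have hTX : KZ.of T - KZ.of X ∈ KZ.relations := by
    have e : KZ.of T - KZ.of X = (KZ.of T - KZ.of X - KZ.of N) + KZ.of N := by abel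
    rw [e]
    exact KZ.relations.add_mem (KZ.integrandAddRel_subset_relations hTXN) hN
  -- (4) the rescaled primitive `R(σ·)/σ` and Newton–Leibniz on the triangle
  obtain ⟨Rσ, hRσ⟩ : ∃ Rσ : (Fin 2 → ℝ) → ℝ, ∀ y, Rσ y = R ((σ : ℝ) • y) / σ := ⟨_, fun _ => rfl⟩
  have hRσs : IsSemialgebraicFunOn ℚ P Rσ := by
    have h1 : IsSemialgebraicFunOn ℚ P (fun y => R ((σ : ℝ) • y)) :=
      IsSemialgebraicFunOn.comp_isSemialgebraicMapOn_holds hRs (isSemialgebraicMapOn_smul hPs σ)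
        fun y hy => hσP hy
    exact ((h1.fun_mul (isSemialgebraicFunOn_const_ratCast hPs σ⁻¹)).congr fun y _ => by
      rw [hRσ, Rat.cast_inv, div_eq_mul_inv])
  have hRσa : ∀ {y}, y ∈ P → AnalyticAt ℝ Rσ y := by
    intro y hy
    rw [show Rσ = _ from funext hRσ]
    have h1 : AnalyticAt ℝ (fun y : Fin 2 → ℝ => R ((σ : ℝ) • y)) y :=
      (hRa _ (hσP hy)).comp (((σ : ℝ) • ContinuousLinearMap.id ℝ (Fin 2 → ℝ)).analyticAt y)
    exact h1.div_const
  have hRσc : ∀ x ∈ KZ.cube 1, ContinuousOn (fun t : ℝ => Rσ (Fin.snoc x t)) (Set.Icc 0 (x 0)) := by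
    intro x hx t ht
    have hmem : (Fin.snoc x t : Fin 2 → ℝ) ∈ P := snoc_mem_lowerTriangle hx ht.1 ht.2
    have hc : ContinuousAt (fun s : ℝ => (Fin.snoc x s : Fin 2 → ℝ)) t := by
      have e : (fun s : ℝ => (Fin.snoc x s : Fin 2 → ℝ)) = Function.update (Fin.snoc x t : Fin 2 → ℝ) (Fin.last 1) := by
        funext s; exact (Fin.update_snoc_last (α := fun _ => ℝ) t x s).symm
      rw [e]
      exact (hasDerivAt_update (Fin.snoc x t : Fin 2 → ℝ) (Fin.last 1) t).continuousAt
    exact ((hRσa hmem).continuousAt.comp hc).continuousWithinAt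
  have hRσd : ∀ x ∈ KZ.cube 1, ∀ t ∈ Set.Ioo 0 (x 0),
      HasDerivAt (fun s : ℝ => Rσ (Fin.snoc x s)) (X.integrand (Fin.snoc x t)) t := by
    intro x hx t ht
    have hmem : (Fin.snoc x t : Fin 2 → ℝ) ∈ P := snoc_mem_lowerTriangle hx ht.1.le ht.2.le
    have hmemσ : (![(σ : ℝ) * x 0, (σ : ℝ) * t] : Fin 2 → ℝ) ∈ P := by
      have h := hPσP hmem
      rwa [snoc_fin_one, smul_vec_two] at h
    have e2 : (fun s : ℝ => Rσ (Fin.snoc x s)) =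
        fun s => ((fun u : ℝ => R ![(σ : ℝ) * x 0, u]) ∘ fun s : ℝ => (σ : ℝ) * s) s / (σ : ℝ) := by
      funext s
      rw [hRσ, snoc_fin_one, smul_vec_two]
      rfl
    rw [e2]
    have hin : HasDerivAt (fun s : ℝ => (σ : ℝ) * s) (σ : ℝ) t := by
      simpa using (hasDerivAt_id t).const_mul (σ : ℝ)
    have hcomp := ((hRtd _ _ hmemσ).comp t hin).div_const (σ : ℝ)
    refine hcomp.congr_deriv ?_
    rw [mul_div_assoc, div_self hσne, mul_one]
    show Rt ![(σ : ℝ) * x 0, (σ : ℝ) * t] = Rt ((σ : ℝ) • (Fin.snoc x t : Fin 2 → ℝ))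
    rw [snoc_fin_one, smul_vec_two]
  -- the boundary representation `Z = [[0,1], s ↦ (R(σs,σs) − R(σs,0))/σ]`
  have hζa : AnalyticOnNhd ℝ (fun x : Fin 1 → ℝ => Rσ (Fin.snoc x (x 0)) - Rσ (Fin.snoc x 0)) (KZ.cube 1) := by
    intro x hx
    have h0 := KZ.mem_cube.1 hx 0
    have e1 : (fun x : Fin 1 → ℝ => (Fin.snoc x (x 0) : Fin 2 → ℝ)) = fun x => fun _ : Fin 2 => x 0 := by
      funext x; rw [snoc_fin_one]; ext i; fin_cases i <;> rfl
    have e2 : (fun x : Fin 1 → ℝ => (Fin.snoc x (0:ℝ) : Fin 2 → ℝ)) =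
        fun x => x 0 • (Pi.single 0 1 : Fin 2 → ℝ) := by
      funext x; rw [snoc_fin_one]; ext i; fin_cases i <;> simp
    have hm1 : (Fin.snoc x (x 0) : Fin 2 → ℝ) ∈ P := snoc_mem_lowerTriangle hx h0.1 le_rfl
    have hm2 : (Fin.snoc x (0:ℝ) : Fin 2 → ℝ) ∈ P := snoc_mem_lowerTriangle hx le_rfl h0.1
    have ha1 : AnalyticAt ℝ (fun x : Fin 1 → ℝ => Rσ (Fin.snoc x (x 0))) x := by
      have hin : AnalyticAt ℝ (fun x : Fin 1 → ℝ => (Fin.snoc x (x 0) : Fin 2 → ℝ)) x := by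
        rw [e1]; exact analyticAt_reindex (fun _ : Fin 2 => (0 : Fin 1)) x
      exact (hRσa hm1).fun_comp_of_eq hin rfl
    have ha2 : AnalyticAt ℝ (fun x : Fin 1 → ℝ => Rσ (Fin.snoc x 0)) x := by
      have hin : AnalyticAt ℝ (fun x : Fin 1 → ℝ => (Fin.snoc x (0:ℝ) : Fin 2 → ℝ)) x := by
        rw [e2]; exact (analyticAt_apply 0 x).smul analyticAt_const
      exact (hRσa hm2).fun_comp_of_eq hin rfl
    exact ha1.sub ha2
  have hζs : IsSemialgebraicFunOn ℚ (KZ.cube 1)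
      (fun x : Fin 1 → ℝ => Rσ (Fin.snoc x (x 0)) - Rσ (Fin.snoc x 0)) := by
    have hc1 : IsSemialgebraic ℚ (KZ.cube 1) := KZ.isSemialgebraic_cube
    have hmap1 : IsSemialgebraicMapOn ℚ (KZ.cube 1) (fun x : Fin 1 → ℝ => (Fin.snoc x (x 0) : Fin 2 → ℝ)) :=
      IsSemialgebraicMapOn.of_forall hc1 fun j => by
        fin_cases j
        · simpa [snoc_fin_one] using isSemialgebraicFunOn_apply hc1 0
        · simpa [snoc_fin_one] using isSemialgebraicFunOn_apply hc1 0
    have hmap2 : IsSemialgebraicMapOn ℚ (KZ.cube 1) (fun x : Fin 1 → ℝ => (Fin.snoc x (0:ℝ) : Fin 2 → ℝ)) :=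
      IsSemialgebraicMapOn.of_forall hc1 fun j => by
        fin_cases j
        · simpa [snoc_fin_one] using isSemialgebraicFunOn_apply hc1 0
        · simpa [snoc_fin_one] using isSemialgebraicFunOn_const_natCast hc1 0
    exact (IsSemialgebraicFunOn.comp_isSemialgebraicMapOn_holds hRσs hmap1
        fun x hx => snoc_mem_lowerTriangle hx (KZ.mem_cube.1 hx 0).1 le_rfl).fun_sub
      (IsSemialgebraicFunOn.comp_isSemialgebraicMapOn_holds hRσs hmap2
        fun x hx => snoc_mem_lowerTriangle hx le_rfl (KZ.mem_cube.1 hx 0).1)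
  set Z : KZ.IntegralRep 1 := KZ.IntegralRep.tameCube _ hζa hζs with hZ
  have hXZ : KZ.of X - KZ.of Z ∈ KZ.relations :=
    triangle_newtonLeibniz rfl hRσs hRσc hRσd Z rfl (fun x _ => rfl)
  have hr' : ∀ i, ∃ ρ : KZ.IntegralRep (n i), ρ.IsTameCube ∧ ρ.integrand = fun z => g i ((σ : ℝ) • z) :=
    fun i => ⟨KZ.IntegralRep.tameCube _ (ha i) (hs i), KZ.IntegralRep.isTameCube_tameCube _ _ _, rfl⟩
  choose r' hr't hr'i using hr'
  have hR : ∀ i, ∃ ρ : KZ.IntegralRep 2, ρ.IsTameCube ∧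
      ρ.integrand = fun v => g i ((σ : ℝ) • (fun l : Fin (n i) => v (Fin.castLE (hn2 i) l))) :=
    fun i => ⟨KZ.IntegralRep.tameCube _ (analyticOnNhd_comp_castLE (hn2 i) (ha i))
      (isSemialgebraicFunOn_cube_comp_castLE (hn2 i) (hs i)), KZ.IntegralRep.isTameCube_tameCube _ _ _, rfl⟩
  choose Rr hRrt hRri using hR
  have hpad : ∀ i, (Rr i).value = (r' i).value := fun i =>
    KZ.Equivalent.value_eq_holds (tame_liftLE (ha i) (hs i) 2 (hn2 i) (Rr i) (hRrt i)
      (fun w _ => by rw [hRri i]) (r' i) (hr't i) (fun x _ => by rw [hr'i i]))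
  have hvalA : A.value = (m₀ : ℝ) + ∑ i, (m i : ℝ) *
      (∫ z in Set.pi Set.univ (fun _ : Fin (n i) => Set.Icc (0:ℝ) 1), g i ((σ : ℝ) • z)) := by
    have hint : ∀ i, Integrable (fun v : Fin 2 → ℝ =>
        g i ((σ : ℝ) • (fun l : Fin (n i) => v (Fin.castLE (hn2 i) l)))) (volume.restrict (KZ.cube 2)) :=
      fun i => by
        have h := (hRrt i).integrableOn
        rw [hRri i] at h
        exact h
    have hvi : ∀ i, (∫ v in KZ.cube 2, g i ((σ : ℝ) • (fun l : Fin (n i) => v (Fin.castLE (hn2 i) l)))) =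
        ∫ z in Set.pi Set.univ (fun _ : Fin (n i) => Set.Icc (0:ℝ) 1), g i ((σ : ℝ) • z) := by
      intro i
      have h1 : (Rr i).value = ∫ v in KZ.cube 2, g i ((σ : ℝ) • (fun l : Fin (n i) => v (Fin.castLE (hn2 i) l))) := by
        rw [(hRrt i).value_eq, hRri i]
      have h2 : (r' i).value = ∫ z in Set.pi Set.univ (fun _ : Fin (n i) => Set.Icc (0:ℝ) 1), g i ((σ : ℝ) • z) := by
        rw [(hr't i).value_eq, hr'i i, KZ.cube_eq_pi]
      rw [← h1, ← h2, hpad i]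
    haveI : IsFiniteMeasure (volume.restrict (KZ.cube 2)) :=
      isFiniteMeasure_restrict.2 (by rw [KZ.volume_cube]; exact ENNReal.one_ne_top)
    rw [hA, KZ.IntegralRep.value_tameCube]
    rw [integral_add (integrable_const _) (integrable_finsetSum _ fun i _ => (hint i).const_mul _),
      integral_finsetSum _ fun i _ => (hint i).const_mul _]
    simp only [integral_const_mul, hvi, setIntegral_const, KZ.volume_real_cube, one_smul]
  have hvalZ : Z.value = ∫ s in Set.Icc (0:ℝ) 1,
      (R ((σ : ℝ) • (![s, s] : Fin 2 → ℝ)) - R ((σ : ℝ) • (![s, 0] : Fin 2 → ℝ))) / σ := by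
    rw [hZ, KZ.IntegralRep.value_tameCube, KZ.cube_eq_pi]
    have h := KZ.DilationLogSector.setIntegral_cube_one
      (fun s : ℝ => (R ((σ : ℝ) • (![s, s] : Fin 2 → ℝ)) - R ((σ : ℝ) • (![s, 0] : Fin 2 → ℝ))) / σ)
    rw [← h]
    refine setIntegral_congr_fun (by rw [← KZ.cube_eq_pi]; exact KZ.measurableSet_cube) fun x _ => ?_
    simp only [hRσ, snoc_fin_one, sub_div]
  refine ⟨A, Z, rfl, fun v => rfl, rfl, fun x => ?_, ?_, hvalA, hvalZ⟩
  · simp only [hZ, KZ.IntegralRep.tameCube_integrand, hRσ, snoc_fin_one, sub_div]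
  · have e : KZ.of A - KZ.of Z = (KZ.of A - KZ.of T) + (KZ.of T - KZ.of X) + (KZ.of X - KZ.of Z) := by abel
    rw [e]
    exact KZ.relations.add_mem (KZ.relations.add_mem hAT hTX) hXZ

/-- **Homogeneous data on the square at a rational scale, EXACT symmetrisation** (`∂R/∂y₁ = F + F∘σ`
on `P`): the package of `homog_scale_moves_rem` with remainder zero. [cite: KontsevichZagier2001, §1.2] -/
theorem homog_scale_moves {S : ℕ} {n : Fin S → ℕ} {g : (i : Fin S) → (Fin (n i) → ℝ) → ℝ}
    {U : (i : Fin S) → Set (Fin (n i) → ℝ)}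
    (hg : ∀ i, IsOpen (U i) ∧ Set.pi Set.univ (fun _ : Fin (n i) => Set.Icc (0:ℝ) 1) ⊆ (U i) ∧
      IsSemialgebraicFunOn ℚ (U i) (g i) ∧ AnalyticOnNhd ℝ (g i) (U i))
    (hn2 : ∀ i, n i ≤ 2) (m : Fin S → ℤ) (m₀ : ℤ)
    {W : Set (Fin 2 → ℝ)} {R : (Fin 2 → ℝ) → ℝ}
    (hPW : {y : Fin 2 → ℝ | y ∈ KZ.cube 2 ∧ y 1 ≤ y 0} ⊆ W)
    (hRs : IsSemialgebraicFunOn ℚ W R) (hRa : AnalyticOnNhd ℝ R W)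
    (hRder : ∀ y ∈ {y : Fin 2 → ℝ | y ∈ KZ.cube 2 ∧ y 1 ≤ y 0}, fderiv ℝ R y (Pi.single 1 1) =
      ((m₀ : ℝ) + ∑ i, (m i : ℝ) * g i (fun l : Fin (n i) => y (Fin.castLE (hn2 i) l))) +
      ((m₀ : ℝ) + ∑ i, (m i : ℝ) * g i (fun l : Fin (n i) => y (Equiv.swap (0 : Fin 2) 1 (Fin.castLE (hn2 i) l)))))
    (σ : ℚ) (hσ0 : 0 < σ) (hσ1 : σ ≤ 1) :
    ∃ (A : KZ.IntegralRep 2) (Z : KZ.IntegralRep 1),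
      A.domain = KZ.cube 2 ∧
      (∀ v, A.integrand v = (m₀ : ℝ) + ∑ i, (m i : ℝ) * g i ((σ : ℝ) • (fun l : Fin (n i) => v (Fin.castLE (hn2 i) l)))) ∧
      Z.domain = KZ.cube 1 ∧
      (∀ x, Z.integrand x = (R ((σ : ℝ) • (![x 0, x 0] : Fin 2 → ℝ)) - R ((σ : ℝ) • (![x 0, 0] : Fin 2 → ℝ))) / σ) ∧
      KZ.of A - KZ.of Z ∈ KZ.relations ∧
      A.value = (m₀ : ℝ) + ∑ i, (m i : ℝ) * (∫ z in Set.pi Set.univ (fun _ : Fin (n i) => Set.Icc (0:ℝ) 1), g i ((σ : ℝ) • z)) ∧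
      Z.value = ∫ s in Set.Icc (0:ℝ) 1, (R ((σ : ℝ) • (![s, s] : Fin 2 → ℝ)) - R ((σ : ℝ) • (![s, 0] : Fin 2 → ℝ))) / σ := by
  set P : Set (Fin 2 → ℝ) := {y : Fin 2 → ℝ | y ∈ KZ.cube 2 ∧ y 1 ≤ y 0} with hP
  have hcubeU : ∀ i, KZ.cube (n i) ⊆ U i := fun i => by rw [KZ.cube_eq_pi]; exact (hg i).2.1
  -- the fibre derivative `Rt = F + F∘σ` of the exact case: Nash near the closed square
  obtain ⟨Rt, hRt⟩ : ∃ Rt : (Fin 2 → ℝ) → ℝ, ∀ y, Rt y =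
      ((m₀ : ℝ) + ∑ i, (m i : ℝ) * g i (fun l : Fin (n i) => y (Fin.castLE (hn2 i) l))) +
      ((m₀ : ℝ) + ∑ i, (m i : ℝ) * g i (fun l : Fin (n i) => y (Equiv.swap (0 : Fin 2) 1 (Fin.castLE (hn2 i) l)))) :=
    ⟨_, fun _ => rfl⟩
  have hFs : IsSemialgebraicFunOn ℚ (KZ.cube 2) (fun v : Fin 2 → ℝ =>
      (m₀ : ℝ) + ∑ i, (m i : ℝ) * g i (fun l : Fin (n i) => v (Fin.castLE (hn2 i) l))) :=
    (isSemialgebraicFunOn_const_intCast KZ.isSemialgebraic_cube m₀).fun_add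
      (IsSemialgebraicFunOn.fun_finsetSum Finset.univ KZ.isSemialgebraic_cube fun i _ =>
        (isSemialgebraicFunOn_const_intCast KZ.isSemialgebraic_cube (m i)).fun_mul
          (isSemialgebraicFunOn_cube_comp_castLE (hn2 i)
            (((hg i).2.2.1).mono (hcubeU i) KZ.isSemialgebraic_cube)))
  have hFa : ∀ v ∈ KZ.cube 2, AnalyticAt ℝ (fun v : Fin 2 → ℝ =>
      (m₀ : ℝ) + ∑ i, (m i : ℝ) * g i (fun l : Fin (n i) => v (Fin.castLE (hn2 i) l))) v := fun v hv =>
    analyticAt_const.fun_add (Finset.analyticAt_fun_sum (f := fun i (v : Fin 2 → ℝ) =>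
      (m i : ℝ) * g i (fun l : Fin (n i) => v (Fin.castLE (hn2 i) l))) Finset.univ
      fun i _ => analyticAt_const.fun_mul
        (analyticOnNhd_comp_castLE (hn2 i) (fun z hz => (hg i).2.2.2 z (hcubeU i hz)) v hv))
  have hswap' : ∀ i, ∀ {v : Fin 2 → ℝ}, v ∈ KZ.cube 2 →
      (fun l : Fin (n i) => v (Equiv.swap (0 : Fin 2) 1 (Fin.castLE (hn2 i) l))) ∈ KZ.cube (n i) :=
    fun i v hv l => KZ.mem_cube.1 hv _
  have hFσs : IsSemialgebraicFunOn ℚ (KZ.cube 2) (fun v : Fin 2 → ℝ =>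
      (m₀ : ℝ) + ∑ i, (m i : ℝ) * g i (fun l : Fin (n i) => v (Equiv.swap (0 : Fin 2) 1 (Fin.castLE (hn2 i) l)))) :=
    (isSemialgebraicFunOn_const_intCast KZ.isSemialgebraic_cube m₀).fun_add
      (IsSemialgebraicFunOn.fun_finsetSum Finset.univ KZ.isSemialgebraic_cube fun i _ =>
        (isSemialgebraicFunOn_const_intCast KZ.isSemialgebraic_cube (m i)).fun_mul
          (IsSemialgebraicFunOn.comp_isSemialgebraicMapOn_holds
            (((hg i).2.2.1).mono (hcubeU i) KZ.isSemialgebraic_cube)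
            (IsSemialgebraicMapOn.of_forall KZ.isSemialgebraic_cube fun l =>
              isSemialgebraicFunOn_apply KZ.isSemialgebraic_cube (Equiv.swap (0 : Fin 2) 1 (Fin.castLE (hn2 i) l)))
            fun v hv => hswap' i hv))
  have hRts : IsSemialgebraicFunOn ℚ P Rt := by
    rw [show Rt = _ from funext hRt]
    exact (hFs.fun_add hFσs).mono (fun y hy => hy.1) isSemialgebraic_lowerTriangle
  have hRta : ∀ y ∈ P, AnalyticAt ℝ Rt y := by
    intro y hy
    rw [show Rt = _ from funext hRt]
    refine (hFa y hy.1).fun_add (analyticAt_const.fun_add (Finset.analyticAt_fun_sum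
      (f := fun i (v : Fin 2 → ℝ) => (m i : ℝ) * g i (fun l : Fin (n i) => v (Equiv.swap (0 : Fin 2) 1 (Fin.castLE (hn2 i) l))))
      Finset.univ fun i _ => analyticAt_const.fun_mul ?_))
    exact ((hg i).2.2.2 _ (hcubeU i (hswap' i hy.1))).fun_comp_of_eq
      (analyticAt_reindex (fun l : Fin (n i) => Equiv.swap (0 : Fin 2) 1 (Fin.castLE (hn2 i) l)) y) rfl
  have hRtc : ContinuousOn Rt P := fun y hy => (hRta y hy).continuousAt.continuousWithinAt
  have hRtd : ∀ a t : ℝ, (![a, t] : Fin 2 → ℝ) ∈ P → HasDerivAt (fun t : ℝ => R ![a, t]) (Rt ![a, t]) t := by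
    intro a t hmem
    have hdf : HasFDerivAt R (fderiv ℝ R ![a, t]) ![a, t] := (hRa _ (hPW hmem)).differentiableAt.hasFDerivAt
    have hpath : HasDerivAt (fun t : ℝ => (![a, t] : Fin 2 → ℝ)) (Pi.single 1 1) t := by
      have e : (fun t' : ℝ => (![a, t'] : Fin 2 → ℝ)) = Function.update (![a, t]) 1 := by
        funext t'; ext i; fin_cases i <;> simp
      rw [e]
      exact hasDerivAt_update _ 1 t
    have h := hdf.comp_hasDerivAt t hpath
    rw [hRt, ← hRder _ hmem]
    exact h
  refine homog_scale_moves_rem hg hn2 m m₀ hPW hRs hRa hRts hRtc hRtd σ hσ0 hσ1 fun N hNd hNi => ?_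
  -- remainder zero: `F(σy) + F((σy)∘swap) = Rt(σy)` on `P`
  refine KZ.of_mem_relations_of_eqOn_zero N fun y hy => ?_
  rw [hNd] at hy
  rw [hNi y hy, hRt, Pi.zero_apply]
  exact sub_eq_zero.2 rfl

/-- **The moves at a rational scale, closed form** (quantifiers in front; registered statement):
see `homog_scale_moves`. [cite: KontsevichZagier2001, §1.2] -/
theorem homog_scale_moves_closed :
    ∀ (S : ℕ) (n : Fin S → ℕ) (g : (i : Fin S) → (Fin (n i) → ℝ) → ℝ) (U : (i : Fin S) → Set (Fin (n i) → ℝ)), (∀ i, IsOpen (U i) ∧ Set.pi Set.univ (fun _ : Fin (n i) => Set.Icc (0:ℝ) 1) ⊆ (U i) ∧ Literature.NumberTheory.Transcendental.IsSemialgebraicFunOn ℚ (U i) (g i) ∧ AnalyticOnNhd ℝ (g i) (U i)) → ∀ (hn2 : ∀ i, n i ≤ 2) (m : Fin S → ℤ) (m₀ : ℤ) (W : Set (Fin 2 → ℝ)) (R : (Fin 2 → ℝ) → ℝ), {y : Fin 2 → ℝ | y ∈ Literature.NumberTheory.Transcendental.KZ.cube 2 ∧ y 1 ≤ y 0} ⊆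 W → Literature.NumberTheory.Transcendental.IsSemialgebraicFunOn ℚ W R → AnalyticOnNhd ℝ R W → (∀ y ∈ {y : Fin 2 → ℝ | y ∈ Literature.NumberTheory.Transcendental.KZ.cube 2 ∧ y 1 ≤ y 0}, fderiv ℝ R y (Pi.single 1 1) = ((m₀ : ℝ) + ∑ i, (m i : ℝ) * g i (fun l : Fin (n i) => y (Fin.castLE (hn2 i) l))) + ((m₀ : ℝ) + ∑ i, (m i : ℝ) * g i (fun l : Fin (n i) => y (Equiv.swap (0 : Fin 2) 1 (Fin.castLE (hn2 i) l))))) → ∀ (σ : ℚ), 0 < σ → σ ≤ 1 → ∃ (A : Literature.NumberTheory.Transcendental.KZ.IntegralRep 2) (Z : Literature.NumberTheory.Transcendental.KZ.IntegralRep 1), A.domain = Literature.NumberTheory.Transcendental.KZ.cube 2 ∧ (∀ v, A.integrand v = (m₀ : ℝ) + ∑ i, (m i : ℝ) * g i ((σ : ℝ) • (fun l : Fin (n i) => v (Fin.castLE (hn2 i) l)))) ∧ Z.domain = Literature.NumberTheory.Transcendental.KZ.cube 1 ∧ (∀ x, Z.integrand x = (R ((σ : ℝ) • (![x 0, x 0]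 : Fin 2 → ℝ)) - R ((σ : ℝ) • (![x 0, 0] : Fin 2 → ℝ))) / σ) ∧ Literature.NumberTheory.Transcendental.KZ.of A - Literature.NumberTheory.Transcendental.KZ.of Z ∈ Literature.NumberTheory.Transcendental.KZ.relations ∧ A.value = (m₀ : ℝ) + ∑ i, (m i : ℝ) * (∫ z in Set.pi Set.univ (fun _ : Fin (n i) => Set.Icc (0:ℝ) 1), g i ((σ : ℝ) • z)) ∧ Z.value = ∫ s in Set.Icc (0:ℝ) 1, (R ((σ : ℝ) • (![s, s] : Fin 2 → ℝ)) - R ((σ : ℝ) • (![s, 0] : Fin 2 → ℝ))) / σ := by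
  intro S n g U hg hn2 m m₀ W R hPW hRs hRa hRder σ hσ0 hσ1
  exact homog_scale_moves hg hn2 m m₀ hPW hRs hRa hRder σ hσ0 hσ1

end Summit.KontsevichZagierPeriods.LiftingCriteria.DilationTransfer
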